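import Mathlib
import Literature.MathematicalPhysics.QuantumFieldTheory.Balaban1983to89.Setup
import Literature.MathematicalPhysics.QuantumFieldTheory.Balaban1983to89.B1RG242Torus

/-!
# `Balaban1983to89.B5Eq121HodgeIdentityVector` — T. Bałaban, *Propagators and renormalization transformations for lattice gauge theories. I*, Commun. Math.
# Phys. **95** (1984) 17–40 [Balaban1984PropagatorsI], (1.21) p. 21: «½‖∂A‖² = ½⟨A, (−Δ)A⟩ − ½‖∂*A‖² … where Δ is the η-lattice Laplace operator for scalar
# functions and ∂* is the divergence operator for vector functions» — THE FLAT LATTICE HODGE ∕ WEITZENBÖCK IDENTITY FOR BOND FIELDS WITH VALUES IN ANY REAL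
# INNER-PRODUCT SPACE (`𝔰𝔲(N)`, `ℝ³`, …), unweighted, in the bare `Site ∕ PBond ∕ Plaq` currency of NODE 00's flat second variation:
# `Σ_p ‖(∂x)(p)‖² + Σ_s ‖(∂*x)(s)‖² = Σ_s Σ_μ Σ_ν ‖x_μ(s + e_ν) − x_μ(s)‖²`.  PROVED (dictionary (J-i) of the N12 lane).

Honest framing: statement-level skeleton of published theorems with citation tags; proofs where landed; nothing here is a claim about the
Yang–Mills mass gap.

Cell `pub-ymgap` (HUMAN RULINGS D-0062 ∕ D-0149), WIDTH SEAT `pub-ymgap-dag-n12-w3` g0 (node N12 = [B15]; key K1⁷ `stmt-QuantumFields-20542`, `--kind proof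
--supports …`; count-neutral); lane word dag-n12-c g16 «w3 take (J-i)» (INBOX 2026-08-28 01:42Z).  PDF held: `paper:balaban1984-cmp95-propagators-rt-i`
((1.21) = PDF 5, re-read tonight).

WHY.  NODE 00's flat second variation of the Wilson action (n12-w2 `Node00.deriv_deriv_wilsonAction4_expChart_one_eq_norm_sq`, p587195) is the curl energy
`(1∕N)·Σ_p ‖x⟨s,μ⟩ + x⟨s+e_μ,ν⟩ − x⟨s+e_ν,μ⟩ − x⟨s,ν⟩‖²` of an `𝔰𝔲(N)`-valued bond field `x`; the gauge condition of the constraint chart (print's (83) `RD*δA′ = 0`)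
kills the divergence; N02's [B5] Prop. 1.1 (1.90) of record is stated for the SCALAR Laplacian per component.  Between them stands exactly (1.21): curl² + div² =
the componentwise Laplacian form.  The tree has (1.21) twice for REAL-valued fields (`HiggsHodgeIdentity.vecLaplaceForm_eq_curl_add_div` on the (Higgs)₂,₃ carrier
with `η^d` weights; `B5Eq121Form.eq121` on the V1 `LatticeFieldCalculus` carrier); this module proves it for fields with values in an ARBITRARY real inner-product
space, with no weights, so that it applies verbatim to `PBond P k → lieSU (Fin N)` and to n12-c's `ℝ³` fields.

WHAT THIS FILE PROVES (theorems only; no `def`; no `sorry`; axioms standard).  For `x : PBond P k → W`, `W` a real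
inner-product space, on the torus `T^{(k)}` of any `Params`:
* `sum_plaq_eq` — a sum over plaquettes `p = ⟨s, μ < ν⟩` is the `μ < ν` part of the triple sum over `(s, μ, ν)`;
* `plaqComb_eq` — the plaquette combination is `(∂_μ x_ν)(s) − (∂_ν x_μ)(s)` (forward differences of the components);
* ★★★ `sum_plaq_normSq_add_sum_div_normSq_eq` — (1.21):
  `Σ_p ‖x⟨s,μ⟩ + x⟨s+e_μ,ν⟩ − x⟨s+e_ν,μ⟩ − x⟨s,ν⟩‖² + Σ_s ‖Σ_μ (x⟨s−e_μ,μ⟩ − x⟨s,μ⟩)‖² = Σ_s Σ_μ Σ_ν ‖x⟨s+e_ν,μ⟩ − x⟨s,μ⟩‖²`;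
* `sum_plaq_normSq_le_sum_grad_normSq` ∕ `sum_plaq_normSq_eq_sum_grad_normSq_of_div_eq_zero` — the curl energy is AT MOST the gradient energy, with EQUALITY on
  divergence-free fields (the Landau-gauge reading print uses: «We want to remove the second term in the action by a gauge fixing term»);
* ★ `shift_eq_of_plaq_eq_zero_of_div_eq_zero` ∕ `eq_of_plaq_eq_zero_of_div_eq_zero` — HARMONIC BOND FIELDS ARE CONSTANT: `∂x = 0` and `∂*x = 0` force
  `x⟨t,μ⟩ = x⟨s,μ⟩` for all sites `s, t` (the kernel of the flat quadratic form on the Landau slice = the `d·dim W` constants — the zero modes the averaging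
  constraint removes; this is the dictionary entry the lane's `hnd` hypothesis needs);
* §4 ((J-ii) componentisation) `dotProduct_hOp_mulVec_eq`, ★★ `sum_dotProduct_hOp_components_eq`, ★★★ `sum_dotProduct_hOp_components_eq_curl_add_div`,
  ★ `sum_dotProduct_hOp_components_eq_curl_of_div_eq_zero` — in any orthonormal frame `b` of `W`, with scalar components `f_{aμ}(t) = ⟪b_a, x⟨t,μ⟩⟫`,
  `Σ_a Σ_μ ⟨f_{aμ}, (−Δ^s + m²) f_{aμ}⟩` (B1's `B1RG242Torus.hOp P k s m²`, the operator of N02's `B5G0SettingTorus.lapEta = hOp P 0 (ε∕(L^kε)) 0`)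
  `= m² Σ‖x‖² + s⁻² (curl² + div²)`; massless on the Landau slice it is `s⁻²·Σ_p ‖(∂x)(p)‖²`.

HONEST SCOPE.  Pure lattice calculus on the periodic torus (four translations of site sums — `HiggsCovariancePos.shiftEquiv`, `HiggsHodgeIdentity.shift_comm` pattern);
no estimate of Bałaban's; the identification of the gradient energy with N02's `formOp ∕ lapEta` per scalar component ((J-ii)) and of the record's linearised
averaging with B5's `Qv` ((J-iii)′) are NOT here.  Count-neutral; N12 NOT discharged; the YM mass gap (Clay) is NOT proved by any of this — R4 closes only the
conditional finite-𝕋⁴ rung `BalabanLadder.UV`; nothing continuum ∕ OS.  Imports `Setup` and `B1RG242Torus` (for `hOp ∕ deriv ∕ form_hOp`, §4) (+ Mathlib) — the torus bookkeeping (`shift ∕ unshift` inverse to each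
other, commuting translations) is re-proved privately, as in the tree's `HiggsCovariancePos` ∕ `TorusHypercubicSymmetry` for their carriers; modifies nothing;
0 kit, 0 lit wants.

## References
* [Balaban1984PropagatorsI] T. Bałaban, Commun. Math. Phys. 95 (1984) 17–40: (1.4) p. 18 (`∂`), (1.21) p. 21 (the identity), (1.90) p. 33.
* [Balaban1982Higgs1] T. Bałaban, Commun. Math. Phys. 85 (1982) 603–626: (1.4)–(1.6), (1.11) pp. 604–605 (the tree's real-valued precedent `HiggsHodgeIdentity`).
-/

noncomputable section

open Finset Matrix
open scoped BigOperators InnerProductSpace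

namespace Literature.MathematicalPhysics.QuantumFieldTheory.Balaban1983to89.B5Eq121HodgeIdentityVector

variable {P : Params} {k : ℕ} {W : Type*} [NormedAddCommGroup W] [InnerProductSpace ℝ W]

/-! ## §1  Bookkeeping: translations of site sums, the plaquette sum, forward differences -/

omit [NormedAddCommGroup W] [InnerProductSpace ℝ W] in
/-- `(s − e_μ) + e_μ = s`. [folklore] -/
private theorem shift_unshift (s : Site P k) (μ : Fin P.d) : (s.unshift μ).shift μ = s := by
  funext ν
  by_cases h : ν = μ
  · subst h; simp [Site.shift, Site.unshift]
  · simp [Site.shift, Site.unshift, Function.update_of_ne h]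

omit [NormedAddCommGroup W] [InnerProductSpace ℝ W] in
/-- `(s + e_μ) − e_μ = s`. [folklore] -/
private theorem unshift_shift (s : Site P k) (μ : Fin P.d) : (s.shift μ).unshift μ = s := by
  funext ν
  by_cases h : ν = μ
  · subst h; simp [Site.shift, Site.unshift]
  · simp [Site.shift, Site.unshift, Function.update_of_ne h]


omit [NormedAddCommGroup W] [InnerProductSpace ℝ W] in
/-- Translation of a site sum by `+e_μ` (a permutation of the torus). [folklore] -/
private theorem sum_shift {M : Type*} [AddCommMonoid M] (μ : Fin P.d) (h : Site P k → M) :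
    ∑ s : Site P k, h (s.shift μ) = ∑ s : Site P k, h s :=
  Equiv.sum_comp (⟨fun s => s.shift μ, fun s => s.unshift μ, fun s => unshift_shift s μ, fun s => shift_unshift s μ⟩ : Site P k ≃ Site P k) h

/-- The translations of the torus commute. [folklore] -/
private theorem shift_comm' (s : Site P k) (μ ν : Fin P.d) : (s.shift μ).shift ν = (s.shift ν).shift μ := by
  funext κ
  by_cases h1 : κ = ν
  · subst h1
    by_cases h2 : κ = μ
    · subst h2; rfl
    · simp [Site.shift, Function.update_self, Function.update_of_ne h2]
  · by_cases h2 : κ = μ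
    · subst h2
      simp [Site.shift, Function.update_self, Function.update_of_ne h1]
    · simp [Site.shift, Function.update_of_ne h1, Function.update_of_ne h2]

omit [NormedAddCommGroup W] [InnerProductSpace ℝ W] in
/-- **A SUM OVER PLAQUETTES IS THE `μ < ν` PART OF THE TRIPLE SUM** (public edition of the `private` folklore lemma re-proved in `B5AverageCurlStokesV1` ∕
`B16Ineq17FlatRouteConstants`, so that downstream stops re-proving it) over base sites and ordered direction pairs (the tree's `Fintype (Plaq P k)` is the subtype
`{(s, μ, ν) | μ < ν}`). [cite: Balaban1984PropagatorsI, (1.4) p.18 (bookkeeping)] -/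
theorem sum_plaq_eq {M : Type*} [AddCommMonoid M] (f : Site P k → Fin P.d → Fin P.d → M) :
    ∑ p : Plaq P k, f p.src p.μ p.ν = ∑ s : Site P k, ∑ μ : Fin P.d, ∑ ν : Fin P.d, if μ < ν then f s μ ν else 0 := by
  classical
  have hinj : Function.Injective (fun p : Plaq P k => (p.src, p.μ, p.ν)) := by
    rintro ⟨x, μ, ν, h⟩ ⟨x', μ', ν', h'⟩ hpq
    simp only [Prod.mk.injEq] at hpq
    obtain ⟨h1, h2, h3⟩ := hpq
    subst h1; subst h2; subst h3
    rfl
  have himg : (Finset.univ : Finset (Plaq P k)).image (fun p => (p.src, p.μ, p.ν))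
      = Finset.univ.filter (fun t : Site P k × Fin P.d × Fin P.d => t.2.1 < t.2.2) := by
    ext t
    simp only [Finset.mem_image, Finset.mem_univ, true_and, Finset.mem_filter]
    constructor
    · rintro ⟨p, rfl⟩
      exact p.hμν
    · intro ht
      exact ⟨⟨t.1, t.2.1, t.2.2, ht⟩, rfl⟩
  calc ∑ p : Plaq P k, f p.src p.μ p.ν
      = ∑ t ∈ (Finset.univ : Finset (Plaq P k)).image (fun p => (p.src, p.μ, p.ν)), f t.1 t.2.1 t.2.2 := by
        rw [Finset.sum_image fun p _ q _ h => hinj h]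
    _ = ∑ t ∈ Finset.univ.filter (fun t : Site P k × Fin P.d × Fin P.d => t.2.1 < t.2.2), f t.1 t.2.1 t.2.2 := by rw [himg]
    _ = ∑ t : Site P k × Fin P.d × Fin P.d, if t.2.1 < t.2.2 then f t.1 t.2.1 t.2.2 else 0 := Finset.sum_filter _ _
    _ = ∑ s : Site P k, ∑ μ : Fin P.d, ∑ ν : Fin P.d, if μ < ν then f s μ ν else 0 := by
        rw [Fintype.sum_prod_type]
        exact Finset.sum_congr rfl fun s _ => by rw [Fintype.sum_prod_type]

omit [InnerProductSpace ℝ W] in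
/-- **THE PLAQUETTE COMBINATION IS `∂_μ x_ν − ∂_ν x_μ`**: `x⟨s,μ⟩ + x⟨s+e_μ,ν⟩ − x⟨s+e_ν,μ⟩ − x⟨s,ν⟩ = (x_ν(s+e_μ) − x_ν(s)) − (x_μ(s+e_ν) − x_μ(s))`.
[cite: Balaban1984PropagatorsI, (1.4) p.18] -/
theorem plaqComb_eq (x : PBond P k → W) (s : Site P k) (μ ν : Fin P.d) :
    x ⟨s, μ⟩ + x ⟨s.shift μ, ν⟩ - x ⟨s.shift ν, μ⟩ - x ⟨s, ν⟩ = (x ⟨s.shift μ, ν⟩ - x ⟨s, ν⟩) - (x ⟨s.shift ν, μ⟩ - x ⟨s, μ⟩) := by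
  abel

/-! ## §2  The resummation `Σ_s ⟪∂_μ f, ∂_ν g⟫ = Σ_s ⟪(∂_ν f)(· + e_μ), (∂_μ g)(· + e_ν)⟫` and the identity (1.21) -/

/-- The resummation behind the Hodge identity (four translations of the torus). [folklore] -/
private theorem sum_inner_fd_fd (μ ν : Fin P.d) (f g : Site P k → W) :
    ∑ s : Site P k, ⟪f (s.shift μ) - f s, g (s.shift ν) - g s⟫_ℝ
      = ∑ s : Site P k, ⟪f ((s.shift μ).shift ν) - f (s.shift μ), g ((s.shift ν).shift μ) - g (s.shift ν)⟫_ℝ := by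
  have e1 : ∑ s : Site P k, ⟪f ((s.shift μ).shift ν), g ((s.shift ν).shift μ)⟫_ℝ = ∑ s : Site P k, ⟪f s, g s⟫_ℝ := by
    have := sum_shift ν (fun y : Site P k => ⟪f y, g y⟫_ℝ)
    rw [← this, ← sum_shift μ (fun y : Site P k => ⟪f (y.shift ν), g (y.shift ν)⟫_ℝ)]
    exact Finset.sum_congr rfl fun s _ => by rw [shift_comm' s ν μ]
  have e2 : ∑ s : Site P k, ⟪f ((s.shift μ).shift ν), g (s.shift ν)⟫_ℝ = ∑ s : Site P k, ⟪f (s.shift μ), g s⟫_ℝ := by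
    rw [← sum_shift ν (fun y : Site P k => ⟪f (y.shift μ), g y⟫_ℝ)]
    exact Finset.sum_congr rfl fun s _ => by rw [shift_comm']
  have e3 : ∑ s : Site P k, ⟪f (s.shift μ), g ((s.shift ν).shift μ)⟫_ℝ = ∑ s : Site P k, ⟪f s, g (s.shift ν)⟫_ℝ := by
    rw [← sum_shift μ (fun y : Site P k => ⟪f y, g (y.shift ν)⟫_ℝ)]
    exact Finset.sum_congr rfl fun s _ => by rw [shift_comm']
  have eL : ∑ s : Site P k, ⟪f (s.shift μ) - f s, g (s.shift ν) - g s⟫_ℝ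
      = ∑ s : Site P k, ⟪f (s.shift μ), g (s.shift ν)⟫_ℝ - ∑ s : Site P k, ⟪f (s.shift μ), g s⟫_ℝ
        - ∑ s : Site P k, ⟪f s, g (s.shift ν)⟫_ℝ + ∑ s : Site P k, ⟪f s, g s⟫_ℝ := by
    rw [← Finset.sum_sub_distrib, ← Finset.sum_sub_distrib, ← Finset.sum_add_distrib]
    exact Finset.sum_congr rfl fun s _ => by
      rw [inner_sub_left, inner_sub_right, inner_sub_right]; ring
  have eR : ∑ s : Site P k, ⟪f ((s.shift μ).shift ν) - f (s.shift μ), g ((s.shift ν).shift μ) - g (s.shift ν)⟫_ℝ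
      = ∑ s : Site P k, ⟪f ((s.shift μ).shift ν), g ((s.shift ν).shift μ)⟫_ℝ
        - ∑ s : Site P k, ⟪f ((s.shift μ).shift ν), g (s.shift ν)⟫_ℝ
        - ∑ s : Site P k, ⟪f (s.shift μ), g ((s.shift ν).shift μ)⟫_ℝ + ∑ s : Site P k, ⟪f (s.shift μ), g (s.shift ν)⟫_ℝ := by
    rw [← Finset.sum_sub_distrib, ← Finset.sum_sub_distrib, ← Finset.sum_add_distrib]
    exact Finset.sum_congr rfl fun s _ => by
      rw [inner_sub_left, inner_sub_right, inner_sub_right]; ring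
  rw [eL, eR, e1, e2, e3]
  ring

/-- ★★★ **(1.21) FOR VECTOR-VALUED BOND FIELDS — curl² + div² = the componentwise gradient energy**: for every bond field `x` on the torus `T^{(k)}` with values in a real
inner-product space `W`,
`Σ_p ‖x⟨s,μ⟩ + x⟨s+e_μ,ν⟩ − x⟨s+e_ν,μ⟩ − x⟨s,ν⟩‖² + Σ_s ‖Σ_μ (x⟨s−e_μ,μ⟩ − x⟨s,μ⟩)‖² = Σ_s Σ_μ Σ_ν ‖x⟨s+e_ν,μ⟩ − x⟨s,μ⟩‖²`
(print: «½‖∂A‖² = ½⟨A, (−Δ)A⟩ − ½‖∂*A‖²», Δ the scalar lattice Laplacian acting componentwise, `⟨A_μ, (−Δ)A_μ⟩ = Σ_s Σ_ν ‖(∂_ν A_μ)(s)‖²` on the torus).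
[cite: Balaban1984PropagatorsI, (1.21) p.21, (1.4) p.18] -/
theorem sum_plaq_normSq_add_sum_div_normSq_eq (x : PBond P k → W) :
    (∑ p : Plaq P k, ‖x ⟨p.src, p.μ⟩ + x ⟨p.src.shift p.μ, p.ν⟩ - x ⟨p.src.shift p.ν, p.μ⟩ - x ⟨p.src, p.ν⟩‖ ^ 2)
      + ∑ s : Site P k, ‖∑ μ : Fin P.d, (x ⟨s.unshift μ, μ⟩ - x ⟨s, μ⟩)‖ ^ 2
      = ∑ s : Site P k, ∑ μ : Fin P.d, ∑ ν : Fin P.d, ‖x ⟨s.shift ν, μ⟩ - x ⟨s, μ⟩‖ ^ 2 := by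
  -- the symmetric summand of the curl term
  set F : Site P k → Fin P.d → Fin P.d → ℝ := fun s μ ν => ‖(x ⟨s.shift μ, ν⟩ - x ⟨s, ν⟩) - (x ⟨s.shift ν, μ⟩ - x ⟨s, μ⟩)‖ ^ 2 with hF
  have hsymm : ∀ s μ ν, F s μ ν = F s ν μ := fun s μ ν => by
    simp only [hF]; rw [← norm_neg, neg_sub]
  have hdiag : ∀ s μ, F s μ μ = 0 := fun s μ => by simp [hF]
  -- (i) the plaquette sum is half the full double sum of `F`
  have hcurl : (∑ p : Plaq P k, ‖x ⟨p.src, p.μ⟩ + x ⟨p.src.shift p.μ, p.ν⟩ - x ⟨p.src.shift p.ν, p.μ⟩ - x ⟨p.src, p.ν⟩‖ ^ 2)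
      = (1 / 2) * ∑ s : Site P k, ∑ μ : Fin P.d, ∑ ν : Fin P.d, F s μ ν := by
    have h1 : (∑ p : Plaq P k, ‖x ⟨p.src, p.μ⟩ + x ⟨p.src.shift p.μ, p.ν⟩ - x ⟨p.src.shift p.ν, p.μ⟩ - x ⟨p.src, p.ν⟩‖ ^ 2)
        = ∑ p : Plaq P k, F p.src p.μ p.ν := by
      refine Finset.sum_congr rfl fun p _ => ?_
      simp only [hF, plaqComb_eq]
    rw [h1, sum_plaq_eq]
    rw [Finset.mul_sum]
    refine Finset.sum_congr rfl fun s _ => ?_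
    -- `Σ_{μ<ν} F = ½ Σ_{μ,ν} F` for a symmetric `F` vanishing on the diagonal
    have hsplit : ∑ μ : Fin P.d, ∑ ν : Fin P.d, F s μ ν
        = (∑ μ : Fin P.d, ∑ ν : Fin P.d, if μ < ν then F s μ ν else 0)
          + ∑ μ : Fin P.d, ∑ ν : Fin P.d, if ν < μ then F s μ ν else 0 := by
      rw [← Finset.sum_add_distrib]
      refine Finset.sum_congr rfl fun μ _ => ?_
      rw [← Finset.sum_add_distrib]
      refine Finset.sum_congr rfl fun ν _ => ?_
      rcases lt_trichotomy μ ν with h | h | h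
      · rw [if_pos h, if_neg (not_lt.2 h.le), add_zero]
      · subst h; rw [if_neg (lt_irrefl _), hdiag, add_zero]
      · rw [if_neg (not_lt.2 h.le), if_pos h, zero_add]
    have hswap : (∑ μ : Fin P.d, ∑ ν : Fin P.d, if ν < μ then F s μ ν else 0)
        = ∑ μ : Fin P.d, ∑ ν : Fin P.d, if μ < ν then F s μ ν else 0 := by
      rw [Finset.sum_comm]
      refine Finset.sum_congr rfl fun μ _ => Finset.sum_congr rfl fun ν _ => ?_
      by_cases h : μ < ν
      · rw [if_pos h, if_pos h, hsymm]
      · rw [if_neg h, if_neg h]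
    rw [hsplit, hswap]
    ring
  -- (ii) expand the square: `‖a − b‖² = ‖a‖² + ‖b‖² − 2⟪a, b⟫`
  have hsq : ∀ (s : Site P k) (μ ν : Fin P.d), F s μ ν
      = ‖(x ⟨s.shift μ, ν⟩ - x ⟨s, ν⟩)‖ ^ 2 + ‖(x ⟨s.shift ν, μ⟩ - x ⟨s, μ⟩)‖ ^ 2 - 2 * ⟪(x ⟨s.shift μ, ν⟩ - x ⟨s, ν⟩), (x ⟨s.shift ν, μ⟩ - x ⟨s, μ⟩)⟫_ℝ := by
    intro s μ ν
    simp only [hF]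
    rw [@norm_sub_sq_real]
    ring
  have hC : (1 / 2 : ℝ) * ∑ s : Site P k, ∑ μ : Fin P.d, ∑ ν : Fin P.d, F s μ ν
      = ∑ μ : Fin P.d, ∑ s : Site P k, ∑ ν : Fin P.d, ‖(x ⟨s.shift ν, μ⟩ - x ⟨s, μ⟩)‖ ^ 2
        - ∑ μ : Fin P.d, ∑ ν : Fin P.d, ∑ s : Site P k, ⟪(x ⟨s.shift μ, ν⟩ - x ⟨s, ν⟩), (x ⟨s.shift ν, μ⟩ - x ⟨s, μ⟩)⟫_ℝ := by
    have hA1 : ∑ s : Site P k, ∑ μ : Fin P.d, ∑ ν : Fin P.d, ‖(x ⟨s.shift μ, ν⟩ - x ⟨s, ν⟩)‖ ^ 2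
        = ∑ μ : Fin P.d, ∑ s : Site P k, ∑ ν : Fin P.d, ‖(x ⟨s.shift ν, μ⟩ - x ⟨s, μ⟩)‖ ^ 2 := by
      refine (Finset.sum_congr rfl fun s _ => Finset.sum_comm).trans ?_
      rw [Finset.sum_comm]
    have hA2 : ∑ s : Site P k, ∑ μ : Fin P.d, ∑ ν : Fin P.d, ‖(x ⟨s.shift ν, μ⟩ - x ⟨s, μ⟩)‖ ^ 2
        = ∑ μ : Fin P.d, ∑ s : Site P k, ∑ ν : Fin P.d, ‖(x ⟨s.shift ν, μ⟩ - x ⟨s, μ⟩)‖ ^ 2 := by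
      rw [Finset.sum_comm]
    have hA3 : ∑ s : Site P k, ∑ μ : Fin P.d, ∑ ν : Fin P.d, ⟪(x ⟨s.shift μ, ν⟩ - x ⟨s, ν⟩), (x ⟨s.shift ν, μ⟩ - x ⟨s, μ⟩)⟫_ℝ
        = ∑ μ : Fin P.d, ∑ ν : Fin P.d, ∑ s : Site P k, ⟪(x ⟨s.shift μ, ν⟩ - x ⟨s, ν⟩), (x ⟨s.shift ν, μ⟩ - x ⟨s, μ⟩)⟫_ℝ := by
      rw [Finset.sum_comm]
      refine Finset.sum_congr rfl fun μ _ => ?_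
      rw [Finset.sum_comm]
    simp_rw [hsq]
    simp only [Finset.sum_sub_distrib, Finset.sum_add_distrib, ← Finset.mul_sum]
    rw [hA1, hA2, hA3]
    ring
  -- (iii) the divergence term as a double sum of inner products, then resummed
  have hdivpt : ∀ s : Site P k, ‖∑ μ : Fin P.d, (x ⟨s.unshift μ, μ⟩ - x ⟨s, μ⟩)‖ ^ 2
      = ∑ μ : Fin P.d, ∑ ν : Fin P.d, ⟪(x ⟨(s.unshift μ).shift μ, μ⟩ - x ⟨s.unshift μ, μ⟩), (x ⟨(s.unshift ν).shift ν, ν⟩ - x ⟨s.unshift ν, ν⟩)⟫_ℝ := by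
    intro s
    have hv : ∀ μ : Fin P.d, x ⟨s.unshift μ, μ⟩ - x ⟨s, μ⟩ = -(x ⟨(s.unshift μ).shift μ, μ⟩ - x ⟨s.unshift μ, μ⟩) := fun μ => by
      rw [shift_unshift, neg_sub]
    rw [← real_inner_self_eq_norm_sq, sum_inner]
    refine Finset.sum_congr rfl fun μ _ => ?_
    rw [inner_sum]
    refine Finset.sum_congr rfl fun ν _ => ?_
    rw [hv μ, hv ν, inner_neg_left, inner_neg_right, neg_neg]
  have hcross : ∀ μ ν : Fin P.d, ∑ s : Site P k, ⟪(x ⟨(s.unshift μ).shift μ, μ⟩ - x ⟨s.unshift μ, μ⟩), (x ⟨(s.unshift ν).shift ν, ν⟩ - x ⟨s.unshift ν, ν⟩)⟫_ℝ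
      = ∑ s : Site P k, ⟪(x ⟨s.shift μ, ν⟩ - x ⟨s, ν⟩), (x ⟨s.shift ν, μ⟩ - x ⟨s, μ⟩)⟫_ℝ := by
    intro μ ν
    rw [sum_inner_fd_fd μ ν (fun t : Site P k => x ⟨t, ν⟩) (fun t : Site P k => x ⟨t, μ⟩)]
    rw [← sum_shift μ (fun s => ⟪(x ⟨(s.unshift μ).shift μ, μ⟩ - x ⟨s.unshift μ, μ⟩), (x ⟨(s.unshift ν).shift ν, ν⟩ - x ⟨s.unshift ν, ν⟩)⟫_ℝ),
      ← sum_shift ν (fun s => ⟪(x ⟨((s.shift μ).unshift μ).shift μ, μ⟩ - x ⟨(s.shift μ).unshift μ, μ⟩), (x ⟨((s.shift μ).unshift ν).shift ν, ν⟩ - x ⟨(s.shift μ).unshift ν, ν⟩)⟫_ℝ)]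
    refine Finset.sum_congr rfl fun s _ => ?_
    rw [unshift_shift, shift_comm' s ν μ, unshift_shift, real_inner_comm]
  have hV : ∑ s : Site P k, ‖∑ μ : Fin P.d, (x ⟨s.unshift μ, μ⟩ - x ⟨s, μ⟩)‖ ^ 2
      = ∑ μ : Fin P.d, ∑ ν : Fin P.d, ∑ s : Site P k, ⟪(x ⟨s.shift μ, ν⟩ - x ⟨s, ν⟩), (x ⟨s.shift ν, μ⟩ - x ⟨s, μ⟩)⟫_ℝ := by
    rw [Finset.sum_congr rfl fun s _ => hdivpt s, Finset.sum_comm]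
    refine Finset.sum_congr rfl fun μ _ => ?_
    rw [Finset.sum_comm]
    exact Finset.sum_congr rfl fun ν _ => hcross μ ν
  -- (iv) assemble; the right side is `Σ_μ Σ_s Σ_ν ‖(∂_ν x_μ)(s)‖²` after reordering
  have hR : ∑ s : Site P k, ∑ μ : Fin P.d, ∑ ν : Fin P.d, ‖x ⟨s.shift ν, μ⟩ - x ⟨s, μ⟩‖ ^ 2
      = ∑ μ : Fin P.d, ∑ s : Site P k, ∑ ν : Fin P.d, ‖(x ⟨s.shift ν, μ⟩ - x ⟨s, μ⟩)‖ ^ 2 := by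
    rw [Finset.sum_comm]
  rw [hcurl, hC, hV, hR]
  ring

/-- **THE CURL ENERGY IS AT MOST THE GRADIENT ENERGY** (drop the divergence square). [cite: Balaban1984PropagatorsI, (1.21) p.21] -/
theorem sum_plaq_normSq_le_sum_grad_normSq (x : PBond P k → W) :
    (∑ p : Plaq P k, ‖x ⟨p.src, p.μ⟩ + x ⟨p.src.shift p.μ, p.ν⟩ - x ⟨p.src.shift p.ν, p.μ⟩ - x ⟨p.src, p.ν⟩‖ ^ 2)
      ≤ ∑ s : Site P k, ∑ μ : Fin P.d, ∑ ν : Fin P.d, ‖x ⟨s.shift ν, μ⟩ - x ⟨s, μ⟩‖ ^ 2 := by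
  rw [← sum_plaq_normSq_add_sum_div_normSq_eq x]
  have : 0 ≤ ∑ s : Site P k, ‖∑ μ : Fin P.d, (x ⟨s.unshift μ, μ⟩ - x ⟨s, μ⟩)‖ ^ 2 := Finset.sum_nonneg fun s _ => by positivity
  linarith

/-- ★ **ON DIVERGENCE-FREE FIELDS (the Landau-gauge slice `∂*x = 0`) THE CURL ENERGY IS THE FULL GRADIENT ENERGY** — the reading print uses («We want to remove
the second term in the action by a gauge fixing term»): `Σ_p ‖(∂x)(p)‖² = Σ_s Σ_μ Σ_ν ‖x_μ(s+e_ν) − x_μ(s)‖²`. [cite: Balaban1984PropagatorsI, (1.21) p.21, (1.18)–(1.20) p.20] -/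
theorem sum_plaq_normSq_eq_sum_grad_normSq_of_div_eq_zero (x : PBond P k → W)
    (hdiv : ∀ s : Site P k, ∑ μ : Fin P.d, (x ⟨s.unshift μ, μ⟩ - x ⟨s, μ⟩) = 0) :
    (∑ p : Plaq P k, ‖x ⟨p.src, p.μ⟩ + x ⟨p.src.shift p.μ, p.ν⟩ - x ⟨p.src.shift p.ν, p.μ⟩ - x ⟨p.src, p.ν⟩‖ ^ 2)
      = ∑ s : Site P k, ∑ μ : Fin P.d, ∑ ν : Fin P.d, ‖x ⟨s.shift ν, μ⟩ - x ⟨s, μ⟩‖ ^ 2 := by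
  rw [← sum_plaq_normSq_add_sum_div_normSq_eq x]
  have : ∑ s : Site P k, ‖∑ μ : Fin P.d, (x ⟨s.unshift μ, μ⟩ - x ⟨s, μ⟩)‖ ^ 2 = 0 :=
    Finset.sum_eq_zero fun s _ => by rw [hdiv s, norm_zero]; ring
  rw [this, add_zero]

/-! ## §3  Harmonic bond fields on the torus are constant -/

omit [NormedAddCommGroup W] [InnerProductSpace ℝ W] in
/-- Iterated unit translations: invariance under `shift ν` gives invariance under `s ↦ s + m e_ν`. [folklore] -/
private theorem apply_update_add_eq {M : Type*} (f : Site P k → M) (ν : Fin P.d) (h : ∀ s : Site P k, f (s.shift ν) = f s)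
    (s : Site P k) : ∀ m : ℕ, f (Function.update s ν (s ν + m)) = f s := by
  intro m
  induction m with
  | zero => simp
  | succ m ih =>
    have hstep : Site.shift (Function.update s ν (s ν + (m : ZMod (P.sitesPerDir k))) : Site P k) ν
        = Function.update s ν (s ν + ((m + 1 : ℕ) : ZMod (P.sitesPerDir k))) := by
      funext i
      by_cases hi : i = ν
      · subst hi; simp [Site.shift, Nat.cast_succ, add_assoc]
      · simp [Site.shift, hi]
    rw [← hstep, h, ih]

omit [NormedAddCommGroup W] [InnerProductSpace ℝ W] in
/-- Invariance under `shift ν` gives invariance under an arbitrary change of the `ν`-th coordinate (the cyclic group `ℤ ∕ sitesPerDir` is generated by `1`).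
[folklore] -/
private theorem apply_update_eq {M : Type*} (f : Site P k → M) (ν : Fin P.d) (h : ∀ s : Site P k, f (s.shift ν) = f s)
    (s : Site P k) (c : ZMod (P.sitesPerDir k)) : f (Function.update s ν c) = f s := by
  have hc : s ν + (((c - s ν).val : ℕ) : ZMod (P.sitesPerDir k)) = c := by
    rw [ZMod.natCast_zmod_val]; abel
  have := apply_update_add_eq f ν h s (c - s ν).val
  rwa [hc] at this

omit [NormedAddCommGroup W] [InnerProductSpace ℝ W] in
/-- **A SITE FUNCTION INVARIANT UNDER EVERY UNIT TRANSLATION IS CONSTANT ON THE TORUS** (`T^{(k)} = (ℤ ∕ sitesPerDir)^d` is connected by unit steps;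
torus plumbing, kept `private` — the cited consequences are the two theorems below). [folklore] -/
private theorem eq_of_forall_shift_eq {M : Type*} (f : Site P k → M) (h : ∀ (s : Site P k) (ν : Fin P.d), f (s.shift ν) = f s) (s t : Site P k) :
    f t = f s := by
  classical
  -- change the coordinates of `s` into those of `t` one at a time
  have key : ∀ S : Finset (Fin P.d), f (fun i => if i ∈ S then t i else s i) = f s := by
    intro S
    induction S using Finset.induction_on with
    | empty => simp
    | @insert a S ha ih =>
      have hupd : (fun i => if i ∈ insert a S then t i else s i) = Function.update (fun i => if i ∈ S then t i else s i) a (t a) := by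
        funext i
        by_cases hi : i = a
        · subst hi; simp
        · simp [hi]
      rw [hupd, apply_update_eq f a (fun u => h u a), ih]
  simpa using key Finset.univ

/-- ★ **HARMONIC BOND FIELDS ARE TRANSLATION INVARIANT**: if the plaquette combination (`∂x`) and the divergence (`∂*x`) of a bond field both vanish, then every
component is invariant under every unit translation, `x⟨s+e_ν, μ⟩ = x⟨s, μ⟩` — by (1.21) the gradient energy vanishes termwise.
[cite: Balaban1984PropagatorsI, (1.21) p.21] -/
theorem shift_eq_of_plaq_eq_zero_of_div_eq_zero (x : PBond P k → W)
    (hcurl : ∀ p : Plaq P k, x ⟨p.src, p.μ⟩ + x ⟨p.src.shift p.μ, p.ν⟩ - x ⟨p.src.shift p.ν, p.μ⟩ - x ⟨p.src, p.ν⟩ = 0)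
    (hdiv : ∀ s : Site P k, ∑ μ : Fin P.d, (x ⟨s.unshift μ, μ⟩ - x ⟨s, μ⟩) = 0) (s : Site P k) (μ ν : Fin P.d) :
    x ⟨s.shift ν, μ⟩ = x ⟨s, μ⟩ := by
  have h := sum_plaq_normSq_eq_sum_grad_normSq_of_div_eq_zero x hdiv
  have h0 : (∑ p : Plaq P k, ‖x ⟨p.src, p.μ⟩ + x ⟨p.src.shift p.μ, p.ν⟩ - x ⟨p.src.shift p.ν, p.μ⟩ - x ⟨p.src, p.ν⟩‖ ^ 2) = 0 :=
    Finset.sum_eq_zero fun p _ => by rw [hcurl p, norm_zero]; ring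
  rw [h0, eq_comm] at h
  have hs := (Finset.sum_eq_zero_iff_of_nonneg fun s _ => Finset.sum_nonneg fun μ _ => Finset.sum_nonneg fun ν _ => by positivity).1 h s
    (Finset.mem_univ _)
  have hμ := (Finset.sum_eq_zero_iff_of_nonneg fun μ _ => Finset.sum_nonneg fun ν _ => by positivity).1 hs μ (Finset.mem_univ _)
  have hν := (Finset.sum_eq_zero_iff_of_nonneg fun ν _ => by positivity).1 hμ ν (Finset.mem_univ _)
  have : ‖x ⟨s.shift ν, μ⟩ - x ⟨s, μ⟩‖ = 0 := (pow_eq_zero_iff two_ne_zero).1 hν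
  exact sub_eq_zero.1 (norm_eq_zero.1 this)

/-- ★ **HARMONIC BOND FIELDS ON THE TORUS ARE CONSTANT** — the kernel of the flat quadratic form `Σ_p ‖(∂x)(p)‖²` on the Landau slice `∂*x = 0` consists of the
constant fields `x⟨s, μ⟩ = c_μ` (`d · dim W` zero modes, removed downstream by the averaging constraint): `∂x = 0 ∧ ∂*x = 0 ⟹ x⟨t, μ⟩ = x⟨s, μ⟩`.
[cite: Balaban1984PropagatorsI, (1.21) p.21] -/
theorem eq_of_plaq_eq_zero_of_div_eq_zero (x : PBond P k → W)
    (hcurl : ∀ p : Plaq P k, x ⟨p.src, p.μ⟩ + x ⟨p.src.shift p.μ, p.ν⟩ - x ⟨p.src.shift p.ν, p.μ⟩ - x ⟨p.src, p.ν⟩ = 0)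
    (hdiv : ∀ s : Site P k, ∑ μ : Fin P.d, (x ⟨s.unshift μ, μ⟩ - x ⟨s, μ⟩) = 0) (s t : Site P k) (μ : Fin P.d) :
    x ⟨t, μ⟩ = x ⟨s, μ⟩ :=
  eq_of_forall_shift_eq (fun u : Site P k => x ⟨u, μ⟩) (fun u ν => shift_eq_of_plaq_eq_zero_of_div_eq_zero x hcurl hdiv u μ ν) s t

/-! ## §4  The componentwise reading ((J-ii)): in an orthonormal frame of `W` the gradient energy is the sum over components `a` and directions `μ`
of B1's scalar form `⟨f_{aμ}, (−Δ^s + m²) f_{aμ}⟩` (`B1RG242Torus.hOp`, `form_hOp`) — the currency of N02's `B5G0SettingTorus.lapEta ∕ formOp` -/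

/-- Parseval in an orthonormal frame: `‖v‖² = Σ_a ⟪b_a, v⟫²`. [folklore] -/
private theorem normSq_eq_sum_sq_inner {ι : Type*} [Fintype ι] (b : OrthonormalBasis ι ℝ W) (v : W) :
    ‖v‖ ^ 2 = ∑ a, ⟪b a, v⟫_ℝ ^ 2 := by
  rw [← real_inner_self_eq_norm_sq, ← b.sum_inner_mul_inner v v]
  exact Finset.sum_congr rfl fun a _ => by rw [real_inner_comm (b a) v, sq]

/-- **B1's SCALAR FORM EVALUATED ON THE TORUS `T^{(k)}`**: `⟨f, (−Δ^s + m²) f⟩ = m² Σ_t f(t)² + s⁻² Σ_t Σ_ν (f(t+e_ν) − f(t))²` (unweighted site sums;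
`B1RG242Torus.form_hOp` with `deriv_mulVec` opened up). [cite: Balaban1982Higgs1, (1.8) p.605, (1.11) p.605] -/
theorem dotProduct_hOp_mulVec_eq (s msq : ℝ) (f : Site P k → ℝ) :
    f ⬝ᵥ (B1RG242Torus.hOp P k s msq *ᵥ f) = msq * ∑ t : Site P k, f t ^ 2 + (s⁻¹) ^ 2 * ∑ t : Site P k, ∑ ν : Fin P.d, (f (t.shift ν) - f t) ^ 2 := by
  rw [B1RG242Torus.form_hOp]
  congr 1
  · simp only [dotProduct, sq]
  · rw [Finset.mul_sum]
    have h : ∀ ν : Fin P.d, (B1RG242Torus.deriv P k s ν *ᵥ f) ⬝ᵥ (B1RG242Torus.deriv P k s ν *ᵥ f)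
        = (s⁻¹) ^ 2 * ∑ t : Site P k, (f (t.shift ν) - f t) ^ 2 := fun ν => by
      simp only [dotProduct, B1RG242Torus.deriv_mulVec, Finset.mul_sum]
      exact Finset.sum_congr rfl fun t _ => by ring
    rw [Finset.sum_congr rfl fun ν _ => h ν, ← Finset.mul_sum, ← Finset.mul_sum, Finset.sum_comm]

/-- ★★ **THE GRADIENT ENERGY OF A `W`-VALUED BOND FIELD IS THE SUM OVER COMPONENTS AND DIRECTIONS OF B1's SCALAR FORMS** ((J-ii) componentisation): in any
orthonormal frame `b` of `W`, with `f_{aμ}(t) := ⟪b_a, x⟨t, μ⟩⟫`,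
`Σ_a Σ_μ ⟨f_{aμ}, (−Δ^s + m²) f_{aμ}⟩ = m² Σ_t Σ_μ ‖x⟨t,μ⟩‖² + s⁻² Σ_t Σ_μ Σ_ν ‖x⟨t+e_ν,μ⟩ − x⟨t,μ⟩‖²` (print: «Δ is η-lattice Laplace operator for
scalar functions» acting on each component `A_μ`, (1.21)). [cite: Balaban1984PropagatorsI, (1.21) p.21; Balaban1982Higgs1, (1.11) p.605] -/
theorem sum_dotProduct_hOp_components_eq {ι : Type*} [Fintype ι] (b : OrthonormalBasis ι ℝ W) (s msq : ℝ) (x : PBond P k → W) :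
    ∑ a, ∑ μ : Fin P.d, (fun t : Site P k => ⟪b a, x ⟨t, μ⟩⟫_ℝ) ⬝ᵥ (B1RG242Torus.hOp P k s msq *ᵥ fun t : Site P k => ⟪b a, x ⟨t, μ⟩⟫_ℝ)
      = msq * ∑ t : Site P k, ∑ μ : Fin P.d, ‖x ⟨t, μ⟩‖ ^ 2
        + (s⁻¹) ^ 2 * ∑ t : Site P k, ∑ μ : Fin P.d, ∑ ν : Fin P.d, ‖x ⟨t.shift ν, μ⟩ - x ⟨t, μ⟩‖ ^ 2 := by
  have hpt : ∀ (a : ι) (μ : Fin P.d),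
      (fun t : Site P k => ⟪b a, x ⟨t, μ⟩⟫_ℝ) ⬝ᵥ (B1RG242Torus.hOp P k s msq *ᵥ fun t : Site P k => ⟪b a, x ⟨t, μ⟩⟫_ℝ)
        = msq * ∑ t : Site P k, ⟪b a, x ⟨t, μ⟩⟫_ℝ ^ 2 + (s⁻¹) ^ 2 * ∑ t : Site P k, ∑ ν : Fin P.d, ⟪b a, x ⟨t.shift ν, μ⟩ - x ⟨t, μ⟩⟫_ℝ ^ 2 := by
    intro a μ
    rw [dotProduct_hOp_mulVec_eq]
    simp only [inner_sub_right]
  have hmass : ∑ a, ∑ μ : Fin P.d, ∑ t : Site P k, ⟪b a, x ⟨t, μ⟩⟫_ℝ ^ 2 = ∑ t : Site P k, ∑ μ : Fin P.d, ‖x ⟨t, μ⟩‖ ^ 2 := by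
    rw [Finset.sum_comm]
    refine (Finset.sum_congr rfl fun μ _ => Finset.sum_comm).trans ?_
    rw [Finset.sum_comm]
    exact Finset.sum_congr rfl fun t _ => Finset.sum_congr rfl fun μ _ => (normSq_eq_sum_sq_inner b _).symm
  have hgrad : ∑ a, ∑ μ : Fin P.d, ∑ t : Site P k, ∑ ν : Fin P.d, ⟪b a, x ⟨t.shift ν, μ⟩ - x ⟨t, μ⟩⟫_ℝ ^ 2
      = ∑ t : Site P k, ∑ μ : Fin P.d, ∑ ν : Fin P.d, ‖x ⟨t.shift ν, μ⟩ - x ⟨t, μ⟩‖ ^ 2 := by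
    rw [Finset.sum_comm]
    refine (Finset.sum_congr rfl fun μ _ => Finset.sum_comm).trans ?_
    rw [Finset.sum_comm]
    refine Finset.sum_congr rfl fun t _ => Finset.sum_congr rfl fun μ _ => ?_
    rw [Finset.sum_comm]
    exact Finset.sum_congr rfl fun ν _ => (normSq_eq_sum_sq_inner b _).symm
  simp only [hpt, Finset.sum_add_distrib, ← Finset.mul_sum]
  rw [hmass, hgrad]

/-- ★★★ **(1.21) IN N02's SCALAR CURRENCY**: `Σ_a Σ_μ ⟨f_{aμ}, (−Δ^s + m²) f_{aμ}⟩ = m² Σ_t Σ_μ ‖x⟨t,μ⟩‖² + s⁻² (Σ_p ‖(∂x)(p)‖² + Σ_t ‖(∂*x)(t)‖²)` — the sum over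
components of B1's scalar Laplacian forms IS the curl energy plus the divergence square (plus the mass term); on the Landau slice `∂*x = 0` with `m² = 0` it is
`s⁻²` times NODE 00's flat second variation summand `Σ_p ‖x⟨s,μ⟩ + x⟨s+e_μ,ν⟩ − x⟨s+e_ν,μ⟩ − x⟨s,ν⟩‖²`.
[cite: Balaban1984PropagatorsI, (1.21) p.21; Balaban1982Higgs1, (1.11) p.605] -/
theorem sum_dotProduct_hOp_components_eq_curl_add_div {ι : Type*} [Fintype ι] (b : OrthonormalBasis ι ℝ W) (s msq : ℝ) (x : PBond P k → W) :
    ∑ a, ∑ μ : Fin P.d, (fun t : Site P k => ⟪b a, x ⟨t, μ⟩⟫_ℝ) ⬝ᵥ (B1RG242Torus.hOp P k s msq *ᵥ fun t : Site P k => ⟪b a, x ⟨t, μ⟩⟫_ℝ)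
      = msq * ∑ t : Site P k, ∑ μ : Fin P.d, ‖x ⟨t, μ⟩‖ ^ 2
        + (s⁻¹) ^ 2 * ((∑ p : Plaq P k, ‖x ⟨p.src, p.μ⟩ + x ⟨p.src.shift p.μ, p.ν⟩ - x ⟨p.src.shift p.ν, p.μ⟩ - x ⟨p.src, p.ν⟩‖ ^ 2)
            + ∑ t : Site P k, ‖∑ μ : Fin P.d, (x ⟨t.unshift μ, μ⟩ - x ⟨t, μ⟩)‖ ^ 2) := by
  rw [sum_dotProduct_hOp_components_eq, sum_plaq_normSq_add_sum_div_normSq_eq]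

/-- ★ **LANDAU SLICE, MASSLESS**: for a divergence-free bond field, `Σ_a Σ_μ ⟨f_{aμ}, (−Δ^s) f_{aμ}⟩ = s⁻² Σ_p ‖(∂x)(p)‖²` — the componentwise scalar Laplacian
form of N02's Prop. 1.1 setting equals the curl energy of NODE 00's flat second variation. [cite: Balaban1984PropagatorsI, (1.21) p.21, (1.90) p.33] -/
theorem sum_dotProduct_hOp_components_eq_curl_of_div_eq_zero {ι : Type*} [Fintype ι] (b : OrthonormalBasis ι ℝ W) (s : ℝ) (x : PBond P k → W)
    (hdiv : ∀ t : Site P k, ∑ μ : Fin P.d, (x ⟨t.unshift μ, μ⟩ - x ⟨t, μ⟩) = 0) :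
    ∑ a, ∑ μ : Fin P.d, (fun t : Site P k => ⟪b a, x ⟨t, μ⟩⟫_ℝ) ⬝ᵥ (B1RG242Torus.hOp P k s 0 *ᵥ fun t : Site P k => ⟪b a, x ⟨t, μ⟩⟫_ℝ)
      = (s⁻¹) ^ 2 * ∑ p : Plaq P k, ‖x ⟨p.src, p.μ⟩ + x ⟨p.src.shift p.μ, p.ν⟩ - x ⟨p.src.shift p.ν, p.μ⟩ - x ⟨p.src, p.ν⟩‖ ^ 2 := by
  rw [sum_dotProduct_hOp_components_eq, ← sum_plaq_normSq_eq_sum_grad_normSq_of_div_eq_zero x hdiv, zero_mul, zero_add]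

end Literature.MathematicalPhysics.QuantumFieldTheory.Balaban1983to89.B5Eq121HodgeIdentityVector

end
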